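import Mathlib.Analysis.Real.Pi.Bounds
import HarnessLib
import Literature.NumberTheory.LFunctions.WeilPositivityCertificate

/-!
# Route SignCone: soundness of SLACK archimedean certificates (`E(g) ≥ -s‖g‖₂²` on `C(a₀)`)

Support for the unconditional rungs of `SignConeOscillatory` / `SignConeInequality`
(items stmt-RiemannHypothesis-16302 / 16301 of route `SignCone`): the unit-slack sign-cone
inequality at cut-off `a` follows from `E(g) ≥ -‖g‖₂²` for all Weil tests `g` supported in
`[-a, a]`, where `E = weilArchQuadratic` is Yoshida's analytic (polar + archimedean) form
(`SignConeUnitSlackReduction.lean`, fake weight `c = 0`).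

The tree certifies `0 ≤ E(g)` on `C((log 2)/2)` by the kernel-checked moment-method certificate
`WeilCert` of `Literature/NumberTheory/LFunctions/WeilPositivityCertificate.lean` (Yoshida 1992,
Thm. 1). Here we prove the SLACK variant of its soundness theorem, for a general support radius
`a₀ = c.a0` and a rational slack `s`:

* `weilArchQuadratic_ge_neg_slack_of_checks`: if the cells and scalar conditions of `c` check, and
  the two parity blocks of the SHIFTED certificate `c' := {c with wL := c.wL + s}` check on the
  moment table `c.nuTab` of `c` (with `0 ≤ κ(c')`), then `-s ‖g‖₂² ≤ E(g)` for every Weil test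
  `g` with `tsupport g ⊆ [-a₀, a₀]`.

The point of the shift: every quantity of the checker except the coefficient `κ` of `‖g‖₂²` is
independent of the level field `wL`, and `κ(c') = rd(κ_exact(c) + s)` — exactly the coefficient
that the slack `s‖g‖₂²` adds to the reduction `E(g) ≥ M* P_r M + κ ‖g‖₂²`. So the in-tree checker
is reused unchanged (its algebraic core `WeilCert.core_nonneg` applied to `c'`), and the proof
below is the proof of `WeilCert.weilArchQuadratic_nonneg_of_check` with the slack carried along
(compare `WeilWindowFlowStrictArchimedeanBottom.lean`, which replays the same proof for the
`log π` margin).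

## References

* H. Yoshida, *On Hermitian forms attached to zeta functions*, Adv. Stud. Pure Math. 21 (1992),
  §6 (the moment method) and Thm. 1.
* The tree's certificate format: `Literature/NumberTheory/LFunctions/WeilPositivityCertificate.lean`.
-/

-- `Summit.RiemannHypothesis.RiemannHypothesis.Theorems` is the prescribed namespace (D-0017:
-- single-conjunct summit, Sub = Summit), so the duplicated component is intended.
set_option linter.dupNamespace false

noncomputable section

open Complex Finset MeasureTheory Set Filter
open scoped Real Topology ComplexConjugate BigOperators

namespace Summit.RiemannHypothesis.RiemannHypothesis.Theorems.SignCone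

open Literature.NumberTheory.LFunctions Literature.NumberTheory.LFunctions.WeilCert

/-! ## The shifted certificate -/

/-- The rounded matrix `P_r` does not depend on the level `wL`: the shifted certificate has the
same `P_r` on any moment table. [folklore] -/
theorem prQ_shift (c : WeilCert) (s : ℚ) (nu : List ℚ) (k l : ℕ) :
    ({ c with wL := c.wL + s } : WeilCert).prQ nu k l = c.prQ nu k l := rfl

/-- The Bessel vector `u` does not depend on the level `wL`. [folklore] -/
theorem uVec_shift (c : WeilCert) (s : ℚ) (M : ℕ → ℂ) (k : ℕ) :
    ({ c with wL := c.wL + s } : WeilCert).uVec M k = c.uVec M k := rfl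

/-- The exact coefficient of `‖g‖₂²` of the shifted certificate is `κ_exact + s`. [folklore] -/
theorem kappaExact_shift (c : WeilCert) (s : ℚ) (nu : List ℚ) :
    ({ c with wL := c.wL + s } : WeilCert).kappaExact nu = c.kappaExact nu + s := by
  unfold WeilCert.kappaExact WeilCert.etaP WeilCert.rhoE WeilCert.nuPrime
  dsimp only
  ring

/-! ## Soundness with slack -/

/-- **Soundness of a slack certificate.** Let `c : WeilCert` and `s : ℚ`. If the cells and the
scalar side conditions of `c` check, and both parity blocks of the shifted certificate
`c' = {c with wL := c.wL + s}` check on the moment table of `c`, with `0 ≤ κ(c')`, then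
`-s ‖g‖₂² ≤ E(g)` for every Weil test function `g` with `tsupport g ⊆ [-a₀, a₀]`, `a₀ = c.a0`.
(The proof of `WeilCert.weilArchQuadratic_nonneg_of_check` with the slack carried along:
`E(g) + s‖g‖₂² ≥ M* P_r M + κ(c') ‖g‖₂² ≥ 0` by Bessel and `WeilCert.core_nonneg` for `c'`.) [folklore] -/
theorem weilArchQuadratic_ge_neg_slack_of_checks {c : WeilCert} {s : ℚ}
    (h : (checkCells c.prec c.wL c.T c.mwT c.cells && c.checkScalars c.nuTab &&
      decide (0 ≤ ({ c with wL := c.wL + s } : WeilCert).kappaQ c.nuTab) &&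
      ({ c with wL := c.wL + s } : WeilCert).checkBlock c.nuTab 0 &&
      ({ c with wL := c.wL + s } : WeilCert).checkBlock c.nuTab 1) = true)
    {g : ℝ → ℂ} (hg : IsWeilTest g) (hsupp : tsupport g ⊆ Icc (-(c.a0 : ℝ)) c.a0) :
    -((s : ℚ) : ℝ) * weilNorm2Sq g ≤ weilArchQuadratic g := by
  simp only [Bool.and_eq_true, decide_eq_true_eq] at h
  obtain ⟨⟨⟨⟨hcells, hsc⟩, hκ'⟩, hb0⟩, hb1⟩ := h
  set c' : WeilCert := { c with wL := c.wL + s } with hc'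
  obtain ⟨h2a, ha1q, hT, haT, hρT, hN, -⟩ := scalars_spec hsc
  set a : ℝ := (c.a0 : ℝ) with ha_def
  have hlog : Real.log 2 / 2 ≤ a := log_two_half_le_of_check h2a
  have ha : 0 < a := lt_of_lt_of_le (by have := Real.log_pos one_lt_two; positivity) hlog
  have ha1 : a ≤ 1 := by rw [ha_def]; exact_mod_cast ha1q
  have hsupp' : tsupport g ⊆ Icc (-a) a := hsupp
  set n := c.N + 1 with hn
  set nu := c.nuTab with hnu
  set M : ℕ → ℂ := weilMoment a g with hM
  set L := weilNorm1 g with hL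
  set N2 := weilNorm2Sq g with hN2
  set z : ℕ → ℕ → ℝ := fun k l ↦ (conj (M k) * M l).re with hz
  have hzsym : ∀ k l, z k l = z l k := fun k l ↦ by
    rw [hz]; simp only; rw [← WeilAna.re_mul_conj_eq, mul_comm]
  have hL0 : 0 ≤ L := weilNorm1_nonneg g
  have hN20 : 0 ≤ N2 := weilNorm2Sq_nonneg g
  have hL1 : L ^ 2 ≤ 2 * a * N2 := weilNorm1_sq_le hg ha hsupp'
  -- the three terms of E(g)
  set P : ℝ := 2 * (weilMellin g 0 * conj (weilMellin g 1)).re with hP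
  set A : ℝ := ∫ t : ℝ, ‖weilMellin g (1 / 2 + t * I)‖ ^ 2 *
    Literature.Analysis.SpecialFunctions.reDigammaQuarter t with hA
  set Γ : ℝ := ∫ t : ℝ, ‖weilMellin g (1 / 2 + t * I)‖ ^ 2 * cellsGamma c.wL c.cells t with hΓ
  have hE : weilArchQuadratic g = P - Real.log π * N2 + 1 / (2 * π) * A := by
    rw [weilArchQuadratic_eq]; rfl
  -- Step A
  set ρ : ℝ := 2 * (a / 2) ^ (c.N + 1) / (c.N + 1).factorial with hρ
  have hρ0 : 0 ≤ ρ := by positivity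
  have hPA : ∑ k ∈ range n, ∑ l ∈ range n,
      (2 * ((-a / 2) ^ k / k.factorial) * ((a / 2) ^ l / l.factorial)) * z k l -
      (8 * ρ + 6 * ρ ^ 2) * L ^ 2 ≤ P := WeilAna.polar_lower_bound hg ha ha1 hsupp' c.N
  rw [polar_symmetrize n a z hzsym] at hPA
  -- Step B
  have hB : (c.wL : ℝ) * (2 * π * N2) - Γ ≤ A := arch_lower_bound hcells hg
  -- Step C
  have hC : Γ ≤ ∑ k ∈ range n, ∑ l ∈ range n, gHat c k l * z k l + 5 * L ^ 2 * (c.nuPrime nu : ℝ) := by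
    have := freq_integral_bound hcells hsc hg (by rwa [← ha_def])
    rw [← ha_def] at this
    exact this
  have hΓ0 : 0 ≤ Γ := integral_nonneg fun t ↦ mul_nonneg (sq_nonneg _) (cellsGamma_nonneg hcells t)
  -- constants
  set q : ℝ := ((invTwoPiHi : ℚ) : ℝ) with hq
  have hq1 : 1 / (2 * π) ≤ q := invTwoPiHi_ge
  have hq0 : 0 ≤ q := invTwoPiHi_nonneg
  have hlogpi : Real.log π ≤ ((logPiHi : ℚ) : ℝ) := logPiHi_ge
  have hν0 : 0 ≤ ((c.nuPrime nu : ℚ) : ℝ) := by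
    unfold WeilCert.nuPrime
    rw [hnu, getV_nuTab (by omega)]
    push_cast
    have ha0q : (0 : ℚ) ≤ c.a0 := by
      have := ha.le; rw [ha_def] at this; exact_mod_cast this
    have := nuQ_nonneg hcells ha0q (q := c.N + 1) ⟨c.nb, by omega⟩
    positivity
  have hpi : 0 < 1 / (2 * π) := by positivity
  -- combine A, B, C
  have hB' : (c.wL : ℝ) * N2 - 1 / (2 * π) * Γ ≤ 1 / (2 * π) * A := by
    calc (c.wL : ℝ) * N2 - 1 / (2 * π) * Γ = 1 / (2 * π) * ((c.wL : ℝ) * (2 * π * N2) - Γ) := by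
          field_simp
      _ ≤ 1 / (2 * π) * A := mul_le_mul_of_nonneg_left hB hpi.le
  have h3 : 1 / (2 * π) * Γ ≤ q * Γ := mul_le_mul_of_nonneg_right hq1 hΓ0
  have h4 : q * Γ ≤ q * (∑ k ∈ range n, ∑ l ∈ range n, gHat c k l * z k l +
      5 * L ^ 2 * (c.nuPrime nu : ℝ)) := mul_le_mul_of_nonneg_left hC hq0
  have h5 : Real.log π * N2 ≤ ((logPiHi : ℚ) : ℝ) * N2 := mul_le_mul_of_nonneg_right hlogpi hN20
  have step1 : ∑ k ∈ range n, ∑ l ∈ range n,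
      ((if k % 2 = l % 2 then
        (-1 : ℝ) ^ k * 2 * ((a / 2) ^ k / k.factorial) * ((a / 2) ^ l / l.factorial) else 0) -
        q * gHat c k l) * z k l +
      ((c.wL : ℝ) - (logPiHi : ℚ)) * N2 -
      ((8 * ρ + 6 * ρ ^ 2) + 5 * q * (c.nuPrime nu : ℝ)) * L ^ 2 ≤ weilArchQuadratic g := by
    rw [hE]
    have e1 : ∑ k ∈ range n, ∑ l ∈ range n,
        ((if k % 2 = l % 2 then
          (-1 : ℝ) ^ k * 2 * ((a / 2) ^ k / k.factorial) * ((a / 2) ^ l / l.factorial) else 0) -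
          q * gHat c k l) * z k l =
        ∑ k ∈ range n, ∑ l ∈ range n,
          (if k % 2 = l % 2 then
            (-1 : ℝ) ^ k * 2 * ((a / 2) ^ k / k.factorial) * ((a / 2) ^ l / l.factorial) else 0) * z k l -
        q * ∑ k ∈ range n, ∑ l ∈ range n, gHat c k l * z k l := by
      rw [Finset.mul_sum, ← Finset.sum_sub_distrib]
      refine Finset.sum_congr rfl fun k _ ↦ ?_
      rw [Finset.mul_sum, ← Finset.sum_sub_distrib]
      refine Finset.sum_congr rfl fun l _ ↦ ?_
      ring
    rw [e1]
    linarith [hPA, hB', h3, h4, h5]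
  -- rewrite the matrix as `pmQ`
  have step2 : ∑ k ∈ range n, ∑ l ∈ range n,
      ((if k % 2 = l % 2 then
        (-1 : ℝ) ^ k * 2 * ((a / 2) ^ k / k.factorial) * ((a / 2) ^ l / l.factorial) else 0) -
        q * gHat c k l) * z k l =
      ∑ k ∈ range n, ∑ l ∈ range n, ((c.pmQ nu k l : ℚ) : ℝ) * z k l := by
    refine Finset.sum_congr rfl fun k hk ↦ Finset.sum_congr rfl fun l hl ↦ ?_
    rw [pmQ_cast (Finset.mem_range.1 hk) (Finset.mem_range.1 hl)]
  rw [step2] at step1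
  -- rounding
  have hMk : ∀ k, ‖M k‖ ≤ L := fun k ↦ norm_weilMoment_le hg ha hsupp' k
  have hround : ∑ k ∈ range n, ∑ l ∈ range n, ((c.prQ nu k l : ℚ) : ℝ) * z k l -
      ∑ k ∈ range n, ∑ l ∈ range n, ((c.pmQ nu k l : ℚ) : ℝ) * z k l ≤
      1 / 2 ^ c.pg * (n : ℝ) ^ 2 * L ^ 2 :=
    WeilAlg.quad_rounding_le n (fun k l ↦ ((c.prQ nu k l : ℚ) : ℝ))
      (fun k l ↦ ((c.pmQ nu k l : ℚ) : ℝ)) (1 / 2 ^ c.pg) L (fun k l ↦ by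
        rw [abs_sub_comm]
        unfold WeilCert.prQ
        exact abs_cast_sub_ratRd_le c.pg (c.pmQ nu k l)) M hMk
  -- κ_exact of the shifted certificate
  have hcoef : 0 ≤ (8 * ρ + 6 * ρ ^ 2) + 5 * q * (c.nuPrime nu : ℝ) + 1 / 2 ^ c.pg * (n : ℝ) ^ 2 := by
    positivity
  have hkex : ((c.kappaExact nu : ℚ) : ℝ) =
      ((c.wL : ℝ) - (logPiHi : ℚ)) -
        2 * a * ((8 * ρ + 6 * ρ ^ 2) + 5 * q * (c.nuPrime nu : ℝ) + 1 / 2 ^ c.pg * (n : ℝ) ^ 2) := by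
    unfold WeilCert.kappaExact WeilCert.etaP WeilCert.rhoE
    push_cast
    rw [hρ, hq, hn, ha_def]
    push_cast
    ring
  have hkex' : ((c'.kappaExact nu : ℚ) : ℝ) = ((c.kappaExact nu : ℚ) : ℝ) + ((s : ℚ) : ℝ) := by
    rw [hc', kappaExact_shift]; push_cast; rfl
  have hκle : ((c'.kappaQ nu : ℚ) : ℝ) ≤ ((c'.kappaExact nu : ℚ) : ℝ) := by
    unfold WeilCert.kappaQ; exact_mod_cast ratRd_le c'.pg _
  have hκ0 : (0 : ℝ) ≤ ((c'.kappaQ nu : ℚ) : ℝ) := by exact_mod_cast hκ'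
  -- E + s N2 ≥ Σ pr z + κ' N2
  have step3 : ∑ k ∈ range n, ∑ l ∈ range n, ((c.prQ nu k l : ℚ) : ℝ) * z k l +
      ((c'.kappaQ nu : ℚ) : ℝ) * N2 ≤ weilArchQuadratic g + ((s : ℚ) : ℝ) * N2 := by
    have h1 : ((c'.kappaQ nu : ℚ) : ℝ) * N2 ≤ ((c'.kappaExact nu : ℚ) : ℝ) * N2 :=
      mul_le_mul_of_nonneg_right hκle hN20
    rw [hkex', hkex] at h1
    have h2 := mul_le_mul_of_nonneg_left hL1 hcoef
    nlinarith [step1, hround, h1, h2]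
  -- Bessel and the algebraic core (for the shifted certificate)
  have hbes : 2 * (∑ k ∈ range n, conj (c'.uVec M k) * M k).re -
      (∑ k ∈ range n, ∑ l ∈ range n, conj (c'.uVec M k) * c'.uVec M l * (gramH a k l : ℂ)).re ≤ N2 :=
    weilNorm2Sq_ge_bessel hg ha hsupp' n (c'.uVec M)
  have hN' : c'.N + 1 = 2 * c'.nb := hN
  have hcore : 0 ≤ (∑ k ∈ range n, ∑ l ∈ range n, ((c.prQ nu k l : ℚ) : ℝ) * z k l) +
      ((c'.kappaQ nu : ℚ) : ℝ) *
        (2 * (∑ k ∈ range n, conj (c'.uVec M k) * M k).re -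
          (∑ k ∈ range n, ∑ l ∈ range n,
            conj (c'.uVec M k) * c'.uVec M l * (gramH a k l : ℂ)).re) := by
    have := core_nonneg (c := c') (nu := nu) hN' hb0 hb1 a ha_def.symm M
    rw [← hn] at this
    exact this
  have h4 := mul_le_mul_of_nonneg_left hbes hκ0
  linarith [step3, h4, hcore]

/-- **Slack certificate, support corollary.** Under the checks of
`weilArchQuadratic_ge_neg_slack_of_checks`, `-s ‖g‖₂² ≤ E(g)` for every Weil test `g`
supported in `[-a, a]` with `a ≤ a₀`. [folklore] -/
theorem weilArchQuadratic_ge_neg_slack_of_checks_of_le {c : WeilCert} {s : ℚ}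
    (h : (checkCells c.prec c.wL c.T c.mwT c.cells && c.checkScalars c.nuTab &&
      decide (0 ≤ ({ c with wL := c.wL + s } : WeilCert).kappaQ c.nuTab) &&
      ({ c with wL := c.wL + s } : WeilCert).checkBlock c.nuTab 0 &&
      ({ c with wL := c.wL + s } : WeilCert).checkBlock c.nuTab 1) = true)
    {a : ℝ} (ha : a ≤ (c.a0 : ℝ)) {g : ℝ → ℂ} (hg : IsWeilTest g)
    (hsupp : tsupport g ⊆ Icc (-a) a) :
    -((s : ℚ) : ℝ) * weilNorm2Sq g ≤ weilArchQuadratic g :=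
  weilArchQuadratic_ge_neg_slack_of_checks h hg
    (hsupp.trans (Icc_subset_Icc (neg_le_neg ha) ha))

end Summit.RiemannHypothesis.RiemannHypothesis.Theorems.SignCone

end
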